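import Literature.Topology.FourManifolds.ModelTemplate
import Literature.Topology.FourManifolds.LoopPerturb
import Literature.Topology.FourManifolds.AffineAmbientIsotopy
import HarnessLib

/-!
# The template knots: affinity in the depth sign, the depth-sign family

Topic `Literature/Topology/FourManifolds` (trunk T-4MAN). Fact seat
`provefact-Literature.Topology.FourManifolds.Knot.IsConnectedSum.isIsotopic` (Schubert's theorem),
geometric heart for rail knots, flattening step. The template loop of `ModelTemplate.lean` is
affine in the depth sign `σ` (`templateRaw_affine`, `template_affine`), hence jointly smooth in
`(σ, s)`; blown down by the crossing chart-affine map of a datum `b` at scale `κ` it is a chart loop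
(`isChartLoopN_blowDown_template`), and the resulting **template knots** for all depth signs are
isotopic (`isIsotopic_templateKnot`, the straight-line family in `σ`).

Everything is proved; no named facts are introduced.

## References

* M. W. Hirsch, *Differential Topology*, Springer GTM 33 (1976), Ch. 8 §1, Thm. 1.3. [HirschDT1976]
-/

open scoped Manifold ContDiff Topology Real
open Function Set Metric Filter

noncomputable section

namespace Literature.Topology.FourManifolds

/-- Local notation: `𝔼 n` is the model Euclidean space `EuclideanSpace ℝ (Fin n)`. -/
local notation "𝔼 " n:arg => EuclideanSpace ℝ (Fin n)

/-- Local notation: `𝕊 n` is the unit sphere in `EuclideanSpace ℝ (Fin (n + 1))`. -/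
local notation "𝕊 " n:arg => (Metric.sphere (0 : EuclideanSpace ℝ (Fin (n + 1))) 1)

attribute [local instance] fact_finrank_euclideanSpace_succ

open KnotsInBall ExitBend ModelTemplate

namespace ModelTemplate

/-! ### Affinity in the depth sign -/

/-- The lower native model is affine in `σ`. [folklore] -/
theorem lowerModel_affine (σ α : ℝ) : lowerModel σ α = lowerModel 0 α + σ • (lowerModel 1 α - lowerModel 0 α) := by
  ext i; fin_cases i <;> (simp [lowerModel, modelLo, pt3]; try ring)

/-- The upper native model is affine in `σ`. [folklore] -/
theorem upperModel_affine (σ α : ℝ) : upperModel σ α = upperModel 0 α + σ • (upperModel 1 α - upperModel 0 α) := by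
  ext i; fin_cases i <;> (simp [upperModel, modelHi, pt3]; try ring)

/-- The segment is affine in `σ`. [folklore] -/
theorem seg_affine (σ p : ℝ) : cO σ + p • dLo σ = (cO 0 + p • dLo 0) + σ • ((cO 1 + p • dLo 1) - (cO 0 + p • dLo 0)) := by
  ext i; fin_cases i <;> (simp [cO, dLo, pt3]; try ring)

/-- The bend arc at time one is affine in `σ`. [folklore] -/
theorem bendArc_affine (σ r p : ℝ) : bendArc σ r p 1 = bendArc 0 r p 1 + σ • (bendArc 1 r p 1 - bendArc 0 r p 1) := by
  ext i; fin_cases i <;> (simp [bendArc, cO, dLo, dHi, pt3]; try ring)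

/-- **THE RAW TEMPLATE IS AFFINE IN THE DEPTH SIGN.** [folklore] -/
theorem templateRaw_affine (σ p : ℝ) : templateRaw σ p = templateRaw 0 p + σ • (templateRaw 1 p - templateRaw 0 p) := by
  rcases le_or_gt p (-(7 / 8)) with h1 | h1
  · simp only [templateRaw_of_le h1]; exact lowerModel_affine σ _
  rcases le_or_gt p (7 / 16) with h2 | h2
  · simp only [templateRaw_of_mem_seg ⟨by linarith, h2⟩]; exact seg_affine σ p
  rcases le_or_gt p 1 with h3 | h3
  · simp only [templateRaw_of_mem_arc ⟨by linarith, h3⟩]; exact bendArc_affine σ _ p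
  rcases le_or_gt p 6 with h4 | h4
  · simp only [templateRaw_of_mem_upper ⟨by linarith, h4⟩]; exact upperModel_affine σ _
  · simp only [templateRaw_of_ge (show (8 / 3 : ℝ) ≤ p by linarith)]; simp

/-- **THE TEMPLATE LOOP IS AFFINE IN THE DEPTH SIGN.** [folklore] -/
theorem template_affine (σ s : ℝ) : template σ s = template 0 s + σ • (template 1 s - template 0 s) := by
  simp only [template, periodise]; exact templateRaw_affine σ _

/-- **The template loop is jointly `C^∞` in `(σ, s)`.** [folklore] -/
theorem contDiff_template_uncurry : ContDiff ℝ ∞ (uncurry template) := by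
  have e : uncurry template = fun q : ℝ × ℝ ↦ template 0 q.2 + q.1 • (template 1 q.2 - template 0 q.2) := by
    funext q; exact template_affine q.1 q.2
  rw [e]
  exact ((contDiff_template 0).comp contDiff_snd).add
    (contDiff_fst.smul (((contDiff_template 1).comp contDiff_snd).sub ((contDiff_template 0).comp contDiff_snd)))

end ModelTemplate

/-! ### The template knots of a datum -/

namespace BandData

variable {A B K : Knot} {avoid : Set (𝕊 3)} (b : BandData A B K avoid)
  (hcross : b.band ⁻¹' sphereEquator 2 ∩ squareNhd b.δ = {x ∈ squareNhd b.δ | x 0 = 2⁻¹}) {κ : ℝ} (hκ : κ ≠ 0)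

/-- The blow-down map has derivative `κ frame` everywhere. [folklore] -/
theorem hasFDerivAt_blowDown (κ : ℝ) (Y : 𝔼 3) :
    HasFDerivAt (b.blowDown hcross κ) (κ • ((b.frame hcross : (𝔼 3) ≃L[ℝ] 𝔼 3) : (𝔼 3) →L[ℝ] 𝔼 3)) Y := by
  have h1 : HasFDerivAt (fun Y : 𝔼 3 ↦ κ • b.frame hcross Y) (κ • ((b.frame hcross : (𝔼 3) ≃L[ℝ] 𝔼 3) : (𝔼 3) →L[ℝ] 𝔼 3)) Y :=
    ((b.frame hcross : (𝔼 3) ≃L[ℝ] 𝔼 3) : (𝔼 3) →L[ℝ] 𝔼 3).hasFDerivAt.const_smul κ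
  exact h1.const_add b.pZero

include hκ in
/-- **The blown-down template is a chart loop.** [folklore] -/
theorem isChartLoopN_blowDown_template (σ : ℝ) : IsChartLoopN fun s ↦ b.blowDown hcross κ (template σ s) := by
  have hT := contDiff_template σ
  refine ⟨(b.contDiff_blowDown hcross κ).comp hT, fun s ↦ by simp only [periodic_template σ s], fun s h0 ↦ ?_, fun s t hst ↦ ?_⟩
  · have hd : HasDerivAt (fun s ↦ b.blowDown hcross κ (template σ s))
        ((κ • ((b.frame hcross : (𝔼 3) ≃L[ℝ] 𝔼 3) : (𝔼 3) →L[ℝ] 𝔼 3)) (deriv (template σ) s)) s :=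
      (b.hasFDerivAt_blowDown hcross κ (template σ s)).comp_hasDerivAt s ((hT.differentiable (by simp)) s).hasDerivAt
    rw [hd.deriv] at h0
    simp only [FunLike.coe_smul, Pi.smul_apply, ContinuousLinearEquiv.coe_coe, smul_eq_zero] at h0
    rcases h0 with h0 | h0
    · exact hκ h0
    · exact deriv_template_ne_zero σ s ((b.frame hcross).injective (h0.trans (map_zero _).symm))
  · have : template σ s = template σ t := by
      have h := congrArg (b.blowUp hcross κ) hst
      simpa only [b.blowUp_blowDown hcross hκ] using h
    exact template_inj σ s t this

/-- **THE TEMPLATE KNOT** of depth sign `σ` at scale `κ` (read back on the sphere through `ψ⁻¹`).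
[folklore] -/
def templateKnot (σ : ℝ) : Knot := (b.isChartLoopN_blowDown_template hcross hκ σ).toKnot

/-- The template knot through `circlePt s`. [folklore] -/
theorem templateKnot_circlePt (σ s : ℝ) : b.templateKnot hcross hκ σ (circlePt s) = psiN.symm (b.blowDown hcross κ (template σ s)) :=
  (b.isChartLoopN_blowDown_template hcross hκ σ).toKnot_circlePt s

/-- **THE TEMPLATE KNOTS OF ALL DEPTH SIGNS ARE ISOTOPIC** (the affine family in `σ`).
[cite: HirschDT1976, Ch. 8 §1, Thm. 1.3] -/
theorem isIsotopic_templateKnot (σ₀ σ₁ : ℝ) : (b.templateKnot hcross hκ σ₀).IsIsotopic (b.templateKnot hcross hκ σ₁) := by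
  -- the family `u ↦ ψ⁻¹ ∘ blowDown ∘ template (σ₀ + u (σ₁ - σ₀))`
  set Cf : ℝ → ℝ → 𝔼 4 := fun u s ↦ ((psiN.symm (b.blowDown hcross κ (template (σ₀ + u * (σ₁ - σ₀)) s)) : 𝕊 3) : 𝔼 4) with hCf
  have hbd := b.contDiff_blowDown hcross κ
  have hC : ContDiff ℝ ∞ (uncurry Cf) := by
    have h1 : ContDiff ℝ ∞ fun q : ℝ × ℝ ↦ template (σ₀ + q.1 * (σ₁ - σ₀)) q.2 :=
      contDiff_template_uncurry.comp ((contDiff_const.add (contDiff_fst.mul contDiff_const)).prodMk contDiff_snd)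
    exact BandData.contDiff_coe_psiN_symm.comp (hbd.comp h1)
  have hreg : ∀ u ∈ Icc (0 : ℝ) 1, IsRegularLoop (Cf u) := fun u _ ↦ (b.isChartLoopN_blowDown_template hcross hκ _).loop
  have hinj : ∀ u ∈ Icc (0 : ℝ) 1, ∀ s t, Cf u s = Cf u t → ∃ m : ℤ, t - s = m := fun u _ ↦
    (b.isChartLoopN_blowDown_template hcross hκ _).inj_coe
  have e₀ : Cf 0 = fun s ↦ ((psiN.symm (b.blowDown hcross κ (template σ₀ s)) : 𝕊 3) : 𝔼 4) := by funext s; simp [hCf]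
  have e₁ : Cf 1 = fun s ↦ ((psiN.symm (b.blowDown hcross κ (template σ₁ s)) : 𝕊 3) : 𝔼 4) := by funext s; simp [hCf]
  exact IsRegularLoop.isIsotopic_of_family_eq (b.isChartLoopN_blowDown_template hcross hκ σ₀).loop
    (b.isChartLoopN_blowDown_template hcross hκ σ₁).loop (b.isChartLoopN_blowDown_template hcross hκ σ₀).inj_coe
    (b.isChartLoopN_blowDown_template hcross hκ σ₁).inj_coe hC hreg hinj e₀ e₁

end BandData

/-! ### Affine images of the template and the affine move -/

namespace ModelTemplate

/-- **An injective affine image of the template loop is a chart loop.** [folklore] -/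
theorem isChartLoopN_affine_template (q : 𝔼 3) {L : (𝔼 3) →L[ℝ] 𝔼 3} (hL : Injective L) (σ : ℝ) :
    IsChartLoopN fun s ↦ q + L (template σ s) := by
  have hT := contDiff_template σ
  refine ⟨contDiff_const.add (L.contDiff.comp hT), fun s ↦ by simp only [periodic_template σ s], fun s h0 ↦ ?_, fun s t hst ↦ ?_⟩
  · have hd : HasDerivAt (fun s ↦ q + L (template σ s)) (L (deriv (template σ) s)) s :=
      (L.hasFDerivAt.comp_hasDerivAt s ((hT.differentiable (by simp)) s).hasDerivAt).const_add q
    rw [hd.deriv] at h0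
    exact deriv_template_ne_zero σ s (hL (h0.trans (map_zero L).symm))
  · exact template_inj σ s t (hL (add_left_cancel hst))

/-- The knot of an injective affine image of the template. [folklore] -/
def affineTemplateKnot (q : 𝔼 3) {L : (𝔼 3) →L[ℝ] 𝔼 3} (hL : Injective L) (σ : ℝ) : Knot :=
  (isChartLoopN_affine_template q hL σ).toKnot

/-- The affine template knot through `circlePt s`. [folklore] -/
theorem affineTemplateKnot_circlePt (q : 𝔼 3) {L : (𝔼 3) →L[ℝ] 𝔼 3} (hL : Injective L) (σ s : ℝ) :
    affineTemplateKnot q hL σ (circlePt s) = psiN.symm (q + L (template σ s)) :=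
  (isChartLoopN_affine_template q hL σ).toKnot_circlePt s

/-- **The affine template knots of all depth signs are isotopic** (the affine family in `σ`, for a
fixed injective affine map). [cite: HirschDT1976, Ch. 8 §1, Thm. 1.3] -/
theorem isIsotopic_affineTemplateKnot_sigma (q : 𝔼 3) {L : (𝔼 3) →L[ℝ] 𝔼 3} (hL : Injective L) (σ₀ σ₁ : ℝ) :
    (affineTemplateKnot q hL σ₀).IsIsotopic (affineTemplateKnot q hL σ₁) := by
  set Cf : ℝ → ℝ → 𝔼 4 := fun u s ↦ ((psiN.symm (q + L (template (σ₀ + u * (σ₁ - σ₀)) s)) : 𝕊 3) : 𝔼 4) with hCf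
  have hC : ContDiff ℝ ∞ (uncurry Cf) := by
    have h1 : ContDiff ℝ ∞ fun p : ℝ × ℝ ↦ template (σ₀ + p.1 * (σ₁ - σ₀)) p.2 :=
      contDiff_template_uncurry.comp ((contDiff_const.add (contDiff_fst.mul contDiff_const)).prodMk contDiff_snd)
    exact BandData.contDiff_coe_psiN_symm.comp (contDiff_const.add (L.contDiff.comp h1))
  have hreg : ∀ u ∈ Icc (0 : ℝ) 1, IsRegularLoop (Cf u) := fun u _ ↦ (isChartLoopN_affine_template q hL _).loop
  have hinj : ∀ u ∈ Icc (0 : ℝ) 1, ∀ s t, Cf u s = Cf u t → ∃ m : ℤ, t - s = m := fun u _ ↦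
    (isChartLoopN_affine_template q hL _).inj_coe
  have e₀ : Cf 0 = fun s ↦ ((psiN.symm (q + L (template σ₀ s)) : 𝕊 3) : 𝔼 4) := by funext s; simp [hCf]
  have e₁ : Cf 1 = fun s ↦ ((psiN.symm (q + L (template σ₁ s)) : 𝕊 3) : 𝔼 4) := by funext s; simp [hCf]
  exact IsRegularLoop.isIsotopic_of_family_eq (isChartLoopN_affine_template q hL σ₀).loop
    (isChartLoopN_affine_template q hL σ₁).loop (isChartLoopN_affine_template q hL σ₀).inj_coe
    (isChartLoopN_affine_template q hL σ₁).inj_coe hC hreg hinj e₀ e₁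

/-- An automorphism composed with the `GL⁺` path matrix is injective. [folklore] -/
theorem injective_comp_path (L₀ L₁ : (𝔼 3) ≃L[ℝ] 𝔼 3) (hdet : 0 < (AffineIsotopy.transition L₀ L₁).det) (t : ℝ) :
    Injective ((L₀ : (𝔼 3) →L[ℝ] 𝔼 3).comp (AffineIsotopy.toCLM (AffineIsotopy.path (AffineIsotopy.transition L₀ L₁) hdet t))) := by
  intro x y hxy
  simp only [ContinuousLinearMap.coe_comp, comp_apply, ContinuousLinearEquiv.coe_coe] at hxy
  have h1 := L₀.injective hxy
  have h2 := congrArg (AffineIsotopy.toCLM (AffineIsotopy.pathInv (AffineIsotopy.transition L₀ L₁) hdet t)) h1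
  rwa [AffineIsotopy.toCLM_pathInv_apply, AffineIsotopy.toCLM_pathInv_apply] at h2

/-- **THE AFFINE MOVE OF THE TEMPLATE**: for automorphisms `L₀, L₁` of `ℝ³` with determinants of
the same sign and any `q₀, q₁, c`, the knots of `q₀ + L₀ (template - c)` and `q₁ + L₁ (template - c)`
are isotopic (the family along the `GL⁺` path of `AffineAmbientIsotopy.lean`).
[cite: HirschDT1976, Ch. 8 §1, Thm. 1.3; Ch. 8 §3, Thm. 3.1 (proof)] -/
theorem isIsotopic_affine_template (q₀ q₁ c : 𝔼 3) (L₀ L₁ : (𝔼 3) ≃L[ℝ] 𝔼 3)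
    (h : 0 < (AffineIsotopy.toMat (L₀ : (𝔼 3) →L[ℝ] 𝔼 3)).det * (AffineIsotopy.toMat (L₁ : (𝔼 3) →L[ℝ] 𝔼 3)).det) (σ : ℝ) :
    (affineTemplateKnot (L := (L₀ : (𝔼 3) →L[ℝ] 𝔼 3)) (q₀ - L₀ c) L₀.injective σ).IsIsotopic
      (affineTemplateKnot (L := (L₁ : (𝔼 3) →L[ℝ] 𝔼 3)) (q₁ - L₁ c) L₁.injective σ) := by
  have hdet := AffineIsotopy.det_transition_pos h
  set A := AffineIsotopy.affinePath q₀ q₁ c L₀ L₁ hdet with hA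
  set M : ℝ → (𝔼 3) →L[ℝ] 𝔼 3 := fun t ↦ (L₀ : (𝔼 3) →L[ℝ] 𝔼 3).comp
    (AffineIsotopy.toCLM (AffineIsotopy.path (AffineIsotopy.transition L₀ L₁) hdet t)) with hM
  -- each stage is an injective affine image of the template
  have hstage : ∀ t s, A t (template σ s) = (q₀ + t • (q₁ - q₀) - M t c) + M t (template σ s) := fun t s ↦ by
    simp only [hA, AffineIsotopy.affinePath, hM, ContinuousLinearMap.coe_comp, comp_apply, ContinuousLinearEquiv.coe_coe,
      map_sub]
    abel
  set Cf : ℝ → ℝ → 𝔼 4 := fun t s ↦ ((psiN.symm (A t (template σ s)) : 𝕊 3) : 𝔼 4) with hCf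
  have hC : ContDiff ℝ ∞ (uncurry Cf) := by
    have h1 : ContDiff ℝ ∞ fun p : ℝ × ℝ ↦ AffineIsotopy.toCLM (AffineIsotopy.path (AffineIsotopy.transition L₀ L₁) hdet p.1) :=
      (AffineIsotopy.contDiff_toCLM_comp (AffineIsotopy.contDiff_path_apply _ hdet)).comp contDiff_fst
    have h2 : ContDiff ℝ ∞ fun p : ℝ × ℝ ↦ A p.1 (template σ p.2) := by
      simp only [hA, AffineIsotopy.affinePath]
      exact (contDiff_const.add (contDiff_fst.smul contDiff_const)).add
        ((L₀ : (𝔼 3) →L[ℝ] 𝔼 3).contDiff.comp (h1.clm_apply (((contDiff_template σ).comp contDiff_snd).sub contDiff_const)))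
    exact BandData.contDiff_coe_psiN_symm.comp h2
  have hloop : ∀ t, IsChartLoopN fun s ↦ A t (template σ s) := fun t ↦ by
    have e : (fun s ↦ A t (template σ s)) = fun s ↦ (q₀ + t • (q₁ - q₀) - M t c) + M t (template σ s) := funext (hstage t)
    rw [e]; exact isChartLoopN_affine_template _ (injective_comp_path L₀ L₁ hdet t) σ
  have hreg : ∀ t ∈ Icc (0 : ℝ) 1, IsRegularLoop (Cf t) := fun t _ ↦ (hloop t).loop
  have hinj : ∀ t ∈ Icc (0 : ℝ) 1, ∀ s s', Cf t s = Cf t s' → ∃ m : ℤ, s' - s = m := fun t _ ↦ (hloop t).inj_coe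
  have h₀ := isChartLoopN_affine_template (L := (L₀ : (𝔼 3) →L[ℝ] 𝔼 3)) (q₀ - L₀ c) L₀.injective σ
  have h₁ := isChartLoopN_affine_template (L := (L₁ : (𝔼 3) →L[ℝ] 𝔼 3)) (q₁ - L₁ c) L₁.injective σ
  have e₀ : Cf 0 = fun s ↦ ((psiN.symm ((q₀ - L₀ c) + (L₀ : (𝔼 3) →L[ℝ] 𝔼 3) (template σ s)) : 𝕊 3) : 𝔼 4) := by
    funext s; simp only [hCf, hA, AffineIsotopy.affinePath_zero, map_sub, ContinuousLinearEquiv.coe_coe]; congr 2; abel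
  have e₁ : Cf 1 = fun s ↦ ((psiN.symm ((q₁ - L₁ c) + (L₁ : (𝔼 3) →L[ℝ] 𝔼 3) (template σ s)) : 𝕊 3) : 𝔼 4) := by
    funext s; simp only [hCf, hA, AffineIsotopy.affinePath_one, map_sub, ContinuousLinearEquiv.coe_coe]; congr 2; abel
  exact IsRegularLoop.isIsotopic_of_family_eq h₀.loop h₁.loop h₀.inj_coe h₁.inj_coe hC hreg hinj e₀ e₁

end ModelTemplate

end Literature.Topology.FourManifolds
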